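import Mathlib
import Summits.Ventures.HodgeRepro.Tier4.Line4.RatioGlue
import Summits.Ventures.HodgeRepro.Tier4.Line4.CurrencyMatch
import Summits.Ventures.HodgeRepro.Tier4.Line4.ProjSetCompactBound

/-!
# Tier4/Line4/RatioAssembly — THE (F) ASSEMBLY: the display (S-RATIO) from (F-c) and the currency match BY NAME, modulo
the (β) unit alone

Blind re-derivation cell `pub-hodge-repro`, Tier 4 «prove the step» (README §9–§10), seat t4-L1-p4 (gen 5; LINE L4; the
last link of the (F) chain announced in S15800).  Tree path `lean/Summits/Ventures/HodgeRepro/Tier4/Line4/RatioAssembly.lean`.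
Imports `Line4/RatioGlue` (this seat, p711153: `ratio_display_of_pieces`, `unit_of_currency_of_beta`), `Line4/CurrencyMatch`
(this seat: `currency_match` = `hcur`), `Line4/ProjSetCompactBound` (t4-L1-p1: (F-c) `exists_measure_inter_projSet_le_of_isCompact_reindex`,
`centreAt`, `levelAt`).  Mathlib-level; no literature; no `def`.

WHAT.  With (F-c) and the currency match on the tree, the glue's two displayed hypotheses `hproj`, `hunit` are discharged
by name; what remains DISPLAYED is the (β) unit `hβ : νf(Z⁰_f · levelTf N) · νf′(levelTf′ N) ≤ M₄ · suppMeasure N γ₀` (`N ≠ 0`; L2-p2's `unit_beta` at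
`unitCurrency W νf lev n = νf(Z⁰_f · levelTf (lev n))` is this binder verbatim)
(typer-1's SaturationMeasure (β1) + ProdSliceBound (β2), L2-p2's UnitInstance), the finiteness `hfin` of the unit
(`suppMeasure_ne_top`), the (S-IDX) cover `hreps` (LevelIndexCount by name in the `_cover` form) and the finiteness of the
archimedean tori.  The level is `q^(n + c₀ + 1)` with `c₀` the existential constant of (F-c) (P2's congruence depth):
* **`ratio_display_of_beta`** — `∃ c₀, ∃ C′, ∀ n (γ : rationalPoints W), (suppMeasureFolded (q^(n+c₀+1)) γ).toReal ≤
  C′ · (suppMeasure (q^(n+c₀+1)) γ₀).toReal`, over ALL rational `γ`, `C′` free of `n` and `γ`;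
* **`ratio_display_of_beta_cover`** — the same with `hreps` BY NAME from `exists_finset_cover_levelDoubleCoset`.
A consumer of TailGlue's `hratio` at `p^(N+n₁)` takes `n₁ := c₀ + 1 + n₁′` (the glue's `lev`); the glue's (S-SEP)/(S-IDX)
levels are monotone in `n₁`, so the deeper level costs nothing (x2's TailGlueRatio binds `hratio_of_pieces` by name).

Nothing here says anything about the status of the Hodge conjecture for CM abelian varieties, which is NOT proved
(HC_CM is NOT proved by anyone in this repository).
-/

set_option autoImplicit false
noncomputable section
namespace Summit.Ventures.HodgeRepro.Tier4.Line4
open Summit.Ventures.HodgeRepro.Tier4 Summit.Ventures.HodgeRepro.Tier4.Common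
  Summit.Ventures.HodgeRepro.Tier4.Line1 MeasureTheory IsDedekindDomain NumberField Matrix
open scoped ENNReal NNReal Pointwise

section Assembly
variable {k : Type} [Field k] [NumberField k] (W : PlaneData k) [MeasurableSpace (GA W)] [BorelSpace (GA W)]
  (R : RTFData W)

/-- **THE (F) ASSEMBLY, modulo (β)**: the display (S-RATIO) over ALL rational `γ` at the levels `q^(n + c₀ + 1)`, from
(F-c) (L1-p1, by name), the currency match (by name), the (S-IDX) cover `hreps`, the (β) unit `hβ` and the finiteness
`hfin` of the unit. -/
theorem ratio_display_of_beta {d : k}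
    (hΩ : W.Ω * W.Ω = -(d • (1 : Matrix (Fin 4) (Fin 4) k)))
    (hd : ¬ IsSquare (-d)) (hΩB : W.Ω * W.B = -(W.B * W.Ωᵀ)) (hPB : ∀ i, W.P i * W.B = W.B * (W.P i)ᵀ)
    (hQB : ∀ j, W.Q j * W.B = W.B * (W.Q j)ᵀ) (hPr : ∀ i, (W.P i).rank = 2) (hQr : ∀ j, (W.Q j).rank = 2)
    (hB : W.B.det ≠ 0) (γ₀ : rationalPoints W) (hreg : IsLinRegular W γ₀) (q : ℕ) (hq : q.Prime)
    (hR : R.IsHaar) (compT : IsCompact (closure R.DT)) (compT' : IsCompact (closure R.DT'))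
    (νinf : Measure (torusInf W)) [νinf.IsHaarMeasure] [IsFiniteMeasure νinf]
    (νf : Measure (torusFin W)) [νf.IsHaarMeasure]
    (c : ℝ≥0) (hc : R.μT = c • Measure.map (torusSplit W).symm (νinf.prod νf))
    (νinf' : Measure (torusInf' W)) [νinf'.IsHaarMeasure] [IsFiniteMeasure νinf']
    (νf' : Measure (torusFin' W)) [νf'.IsHaarMeasure]
    (c' : ℝ≥0) (hc' : R.μT' = c' • Measure.map (torusSplit' W).symm (νinf'.prod νf'))
    (νS : Measure (torusFinAt W (placesAbove (k := k) q))) [νS.IsHaarMeasure]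
    (νA : Measure (torusFinAway W (placesAbove (k := k) q))) [νA.IsHaarMeasure]
    (cq : ℝ≥0) (hcq : νf = cq • Measure.map (torusFinSplit W (placesAbove (k := k) q)).symm (νS.prod νA))
    (DZf : Set (torusFin W))
    (M₁ : ℕ) (hreps : ∀ m : ℕ, ∃ reps : Finset (GA W), reps.card ≤ M₁ ∧
      levelDoubleCoset W (q ^ m) (GA.ofFinPart W (γ₀ : GA W)) ⊆ ⋃ g ∈ reps, g • (levelK W (q ^ m) : Set (GA W)))
    (M₄ : ℝ≥0∞) (hM₄ : M₄ ≠ ⊤)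
    (hβ : ∀ N : ℕ, N ≠ 0 → νf (((ZfIn W : Set (torusFin W)) ∩ levelTf W 1) * levelTf W N) * νf' (levelTf' W N) ≤
      M₄ * suppMeasure W νf νf' (γ₀ : GA W) DZf N (γ₀ : GA W))
    (hfin : ∀ N : ℕ, N ≠ 0 → suppMeasure W νf νf' (γ₀ : GA W) DZf N (γ₀ : GA W) ≠ ⊤) :
    ∃ c₀ : ℕ, ∃ C' : ℝ, ∀ (n : ℕ) (γ : rationalPoints W),
      (suppMeasureFolded W R (γ₀ : GA W) (q ^ (n + c₀ + 1)) (γ : GA W)).toReal ≤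
        C' * (suppMeasure W νf νf' (γ₀ : GA W) DZf (q ^ (n + c₀ + 1)) (γ₀ : GA W)).toReal := by
  haveI : BorelSpace (torusT W) := Subtype.borelSpace _
  -- the compact cut
  have hC : IsCompact (finTf W '' closure R.DT) := isCompact_finTf_image_closure_DT W R compT
  -- (F-c), re-indexed: `c₀`, `κ`
  obtain ⟨c₀, κ, hproj⟩ := exists_measure_inter_projSet_le_of_isCompact_reindex W hΩ hd hΩB hPB hQB hPr hQr hB γ₀
    hreg q hq (placesAbove (k := k) q) (fun _ hv => hv) νf νS νA hcq hC
  -- the currency match at `c₀`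
  obtain ⟨M₃, hM₃, hcur⟩ := currency_match W q c₀ hq.ne_zero νf νS νA cq hcq hC
  refine ⟨c₀, ?_⟩
  -- the currency `u n` and the unit currency `v n`
  set u : ℕ → ℝ≥0∞ := fun n => (cq : ℝ≥0∞) *
    νS (((centreAt W (placesAbove (k := k) q) ⊓ levelAt W (placesAbove (k := k) q) 1 : Subgroup _) :
        Set (torusFinAt W (placesAbove (k := k) q))) *
      (levelAt W (placesAbove (k := k) q) (q ^ (n + 1)) : Set (torusFinAt W (placesAbove (k := k) q)))) *
    νA (awayTf W (placesAbove (k := k) q) '' (finTf W '' closure R.DT)) with hu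
  set v : ℕ → ℝ≥0∞ := fun n =>
    νf (((ZfIn W : Set (torusFin W)) ∩ levelTf W 1) * levelTf W (q ^ (n + c₀ + 1))) with hv
  have hproj' : ∀ (n : ℕ) (γ : GA W),
      νf (finTf W '' closure R.DT ∩ projSet W (γ₀ : GA W) (q ^ (n + c₀ + 1)) γ) ≤ (κ : ℝ≥0∞) * u n := by
    intro n γ
    refine (hproj n γ).trans (le_of_eq ?_)
    simp only [hu]
    ring
  have hcur' : ∀ n, u n ≤ M₃ * v n := by
    intro n
    have h := hcur (n + 1)
    simp only [hu, hv]
    rw [show n + 1 + c₀ = n + c₀ + 1 by omega] at h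
    exact h
  have hunit := unit_of_currency_of_beta W νf νf' (γ₀ : GA W) DZf (fun n => q ^ (n + c₀ + 1)) u v M₃ M₄ hcur'
    (fun n => hβ (q ^ (n + c₀ + 1)) (pow_ne_zero _ hq.ne_zero))
  exact ratio_display_of_pieces W R hR compT compT' νinf νf c hc νinf' νf' c' hc' (γ₀ : GA W) DZf
    (fun n => q ^ (n + c₀ + 1)) (fun n => pow_ne_zero _ hq.ne_zero) M₁ (fun n => hreps (n + c₀ + 1)) u κ
    (ENNReal.natCast_ne_top κ) hproj' (M₃ * M₄) (ENNReal.mul_ne_top hM₃ hM₄) hunit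
    (fun n => hfin (q ^ (n + c₀ + 1)) (pow_ne_zero _ hq.ne_zero))

/-- **THE (F) ASSEMBLY with (S-IDX) BY NAME**: `hreps` from LevelIndexCount's `exists_finset_cover_levelDoubleCoset` at
`γ₀,f` under the integrality of `γ₀, γ₀⁻¹` above `q` (LevelPrime's clause). -/
theorem ratio_display_of_beta_cover {d : k}
    (hΩ : W.Ω * W.Ω = -(d • (1 : Matrix (Fin 4) (Fin 4) k)))
    (hd : ¬ IsSquare (-d)) (hΩB : W.Ω * W.B = -(W.B * W.Ωᵀ)) (hPB : ∀ i, W.P i * W.B = W.B * (W.P i)ᵀ)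
    (hQB : ∀ j, W.Q j * W.B = W.B * (W.Q j)ᵀ) (hPr : ∀ i, (W.P i).rank = 2) (hQr : ∀ j, (W.Q j).rank = 2)
    (hB : W.B.det ≠ 0) (γ₀ : rationalPoints W) (hreg : IsLinRegular W γ₀) (q : ℕ) (hq : q.Prime)
    (hγ₀ : ∀ v : HeightOneSpectrum (𝓞 k), (q : 𝓞 k) ∈ v.asIdeal → ∀ i j,
      Valued.v (finPart k (GA.mat W (GA.ofFinPart W (γ₀ : GA W)) i j) v) ≤ 1)
    (hγ₀' : ∀ v : HeightOneSpectrum (𝓞 k), (q : 𝓞 k) ∈ v.asIdeal → ∀ i j,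
      Valued.v (finPart k (GA.mat W (GA.ofFinPart W (γ₀ : GA W))⁻¹ i j) v) ≤ 1)
    (hR : R.IsHaar) (compT : IsCompact (closure R.DT)) (compT' : IsCompact (closure R.DT'))
    (νinf : Measure (torusInf W)) [νinf.IsHaarMeasure] [IsFiniteMeasure νinf]
    (νf : Measure (torusFin W)) [νf.IsHaarMeasure]
    (c : ℝ≥0) (hc : R.μT = c • Measure.map (torusSplit W).symm (νinf.prod νf))
    (νinf' : Measure (torusInf' W)) [νinf'.IsHaarMeasure] [IsFiniteMeasure νinf']
    (νf' : Measure (torusFin' W)) [νf'.IsHaarMeasure]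
    (c' : ℝ≥0) (hc' : R.μT' = c' • Measure.map (torusSplit' W).symm (νinf'.prod νf'))
    (νS : Measure (torusFinAt W (placesAbove (k := k) q))) [νS.IsHaarMeasure]
    (νA : Measure (torusFinAway W (placesAbove (k := k) q))) [νA.IsHaarMeasure]
    (cq : ℝ≥0) (hcq : νf = cq • Measure.map (torusFinSplit W (placesAbove (k := k) q)).symm (νS.prod νA))
    (DZf : Set (torusFin W)) (M₄ : ℝ≥0∞) (hM₄ : M₄ ≠ ⊤)
    (hβ : ∀ N : ℕ, N ≠ 0 → νf (((ZfIn W : Set (torusFin W)) ∩ levelTf W 1) * levelTf W N) * νf' (levelTf' W N) ≤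
      M₄ * suppMeasure W νf νf' (γ₀ : GA W) DZf N (γ₀ : GA W))
    (hfin : ∀ N : ℕ, N ≠ 0 → suppMeasure W νf νf' (γ₀ : GA W) DZf N (γ₀ : GA W) ≠ ⊤) :
    ∃ c₀ : ℕ, ∃ C' : ℝ, ∀ (n : ℕ) (γ : rationalPoints W),
      (suppMeasureFolded W R (γ₀ : GA W) (q ^ (n + c₀ + 1)) (γ : GA W)).toReal ≤
        C' * (suppMeasure W νf νf' (γ₀ : GA W) DZf (q ^ (n + c₀ + 1)) (γ₀ : GA W)).toReal := by
  obtain ⟨M₁, hM₁⟩ := exists_finset_cover_levelDoubleCoset W (ofFinPart_mem_finitePart W (γ₀ : GA W)) q hγ₀ hγ₀'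
  exact ratio_display_of_beta W R hΩ hd hΩB hPB hQB hPr hQr hB γ₀ hreg q hq hR compT compT' νinf νf c hc νinf' νf'
    c' hc' νS νA cq hcq DZf M₁ hM₁ M₄ hM₄ hβ hfin

end Assembly

end Summit.Ventures.HodgeRepro.Tier4.Line4

end
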